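import Literature.NumberTheory.GaloisRepresentations.HeckeCharacterModulusExponentProofs
import Literature.NumberTheory.GaloisRepresentations.HeckeCharacterRamificationProofs
import Literature.NumberTheory.GaloisRepresentations.HeckeCharacterProofs
import Literature.NumberTheory.LFunctions.RayClassLSeriesDirichlet
import HarnessLib

set_option linter.dupNamespace false
set_option autoImplicit false

/-!
# Rigidity bridge (R1): the Hecke `L`-function of an ARBITRARY Hecke character as an `ℕ`-indexed
# Dirichlet series (translate of the unitary part)

Helper file for the K7r Value crux `EllipticUnitValueSevenOfGZK` (stmt-BirchSwinnertonDyer-19945), line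
`rubin-formula-zp` v4.1, registered stub H_Rig `stub_pinnedCharacterStructureSeven`
(`X12.O11.RamifiedCMPinnedCharacterStructureAtZp W 7`: every Hecke character L-pinned to the CM curve is the
Deuring character or its conjugate). Step (R1) of the cell's plan (planner D144/D154, seat k7r-c2 06:05Z):
to compare an L-pinned `φ` with `ψ` through `heckeLFunction φ s = heckeLFunction ψ s` one needs BOTH sides
as genuine Dirichlet series over `ℕ` so that Mathlib's coefficient uniqueness
(`LSeries_eq_iff_of_abscissaOfAbsConv_lt_top`) applies. The tree has all ingredients:

* the tree's `heckeLFunction χ` is a `tprod` over the unramified places (`HeckeCharacter.lean`);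
* for a function `ψ` on places with `‖ψ v‖ ≤ 1` off a modulus `𝔪`, Neukirch VII (8.1):
  `LFunctions.rayClassLSeries 𝔪 ψ s = ∏'_{v ∤ 𝔪} (1 − ψ v · Nv^{−s})⁻¹` (`rayClassLSeries_eq_tprod`) and
  `= LSeries (NumberField.twistCount K (rayClassCoeffHom 𝔪 ψ)) s` (`rayClassLSeries_eq_LSeries_twistCount`),
  `re s > 1`;
* Weil BNT VII §3–§7 (k8i-ty g17, `HeckeCharacterModulusExponentProofs`): every Hecke character is
  `χ = χ₀ · ‖·‖^σ` with `χ₀` unitary, and `heckeLFunction χ s = heckeLFunction χ₀ (s + σ)`.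

This file assembles: `exists_ramificationModulus` (a nonzero ideal `𝔪` with `v ∣ 𝔪 ↔ χ` ramified at `v`
— the product of the finitely many ramified primes); `heckeLFunction_eq_rayClassLSeries_of_isUnitary` and
`heckeLFunction_eq_LSeries_twistCount_of_isUnitary` (unitary `χ`, `re s > 1`); and for an ARBITRARY `χ`
`exists_heckeLFunction_eq_LSeries_translate`: `∃ σ χ₀ 𝔪`, `χ₀` unitary with the same ramification and
`χ₀(ϖ_v) = χ(ϖ_v)·Nv^σ`, such that `heckeLFunction χ s = LSeries (twistCount K (rayClassCoeffHom 𝔪 χ₀(ϖ·))) (s + σ)`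
for `re s > 1 − σ`.

References: Neukirch, *Algebraic Number Theory*, VII (8.1)–(8.2); Weil, *Basic Number Theory*, VII §3, §7.
-/

noncomputable section

open scoped Classical
open NumberField IsDedekindDomain
  Literature.NumberTheory.GaloisRepresentations
  Literature.NumberTheory.LFunctions

namespace Summit.BirchSwinnertonDyer.BirchSwinnertonDyer.Theorems.RamifiedSevenEllipticUnits

namespace Rigidity

variable {K : Type} [Field K] [NumberField K]

/-- **A ramification modulus**: for every Hecke character `χ` there is a nonzero ideal `𝔪` of `𝓞_K`
with `𝔪 ≤ v ↔ χ` ramified at `v` (the product of the finitely many ramified primes,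
`finite_ramifiedPlaces_holds`). [cite: NeukirchANT1999, Ch. VII §6 (6.12) (proof)] -/
theorem exists_ramificationModulus (χ : HeckeCharacter K) :
    ∃ 𝔪 : Ideal (𝓞 K), 𝔪 ≠ ⊥ ∧ ∀ v : HeightOneSpectrum (𝓞 K), χ.IsUnramifiedAt v ↔ ¬ 𝔪 ≤ v.asIdeal := by
  have hfin : (χ.ramifiedPlaces).Finite := HeckeCharacter.finite_ramifiedPlaces_holds χ
  refine ⟨∏ v ∈ hfin.toFinset, v.asIdeal, ?_, fun v ↦ ?_⟩
  · rw [Ne, ← Ideal.zero_eq_bot]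
    exact Finset.prod_ne_zero_iff.mpr fun w _ ↦ by rw [Ideal.zero_eq_bot]; exact w.ne_bot
  · constructor
    · intro hv hle
      haveI := v.isPrime
      obtain ⟨w, hw, hwv⟩ := (Ideal.IsPrime.prod_le inferInstance).mp hle
      have hwv' : w = v := HeightOneSpectrum.ext (w.isMaximal.eq_of_le v.isPrime.ne_top hwv)
      rw [Set.Finite.mem_toFinset] at hw
      exact hw (hwv' ▸ hv)
    · intro hle
      by_contra hv
      have hmem : v ∈ hfin.toFinset := by rw [Set.Finite.mem_toFinset]; exact hv
      exact hle (Ideal.le_of_dvd (Finset.dvd_prod_of_mem _ hmem))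

/-- **`L(χ, s) = Σ_𝔞 χ(𝔞) N𝔞^{−s}` for a UNITARY Hecke character, `re s > 1`** — the idelic Euler product
over the unramified places equals the ideal-indexed series of `𝔞 ↦ χ(𝔞)` (extended by `0` on ideals not
prime to the ramification modulus `𝔪`). [cite: NeukirchANT1999, Ch. VII §8 (8.1)–(8.2)] -/
theorem heckeLFunction_eq_rayClassLSeries_of_isUnitary {χ : HeckeCharacter K} (hu : χ.IsUnitary)
    {𝔪 : Ideal (𝓞 K)} (h𝔪 : 𝔪 ≠ ⊥)
    (hiff : ∀ v : HeightOneSpectrum (𝓞 K), χ.IsUnramifiedAt v ↔ ¬ 𝔪 ≤ v.asIdeal)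
    {s : ℂ} (hs : 1 < s.re) :
    heckeLFunction χ s = rayClassLSeries 𝔪 (fun v ↦ χ.valueAtUniformizer v) s := by
  rw [rayClassLSeries_eq_tprod h𝔪 (fun v _ ↦ (HeckeCharacter.norm_valueAtUniformizer_of_isUnitary hu v).le) hs,
    heckeLFunction]
  let e : {v : HeightOneSpectrum (𝓞 K) // χ.IsUnramifiedAt v} ≃
      {v : HeightOneSpectrum (𝓞 K) // ¬ 𝔪 ≤ v.asIdeal} := Equiv.subtypeEquivRight fun v ↦ hiff v
  rw [← Equiv.tprod_eq e]
  exact tprod_congr fun v ↦ rfl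

/-- **`L(χ, s)` as an `ℕ`-indexed Dirichlet series for a UNITARY `χ`**: `= LSeries (n ↦ Σ_{N𝔞 = n} χ(𝔞)) s`,
`re s > 1`. [cite: NeukirchANT1999, Ch. VII §8 (8.1)] -/
theorem heckeLFunction_eq_LSeries_twistCount_of_isUnitary {χ : HeckeCharacter K} (hu : χ.IsUnitary)
    {𝔪 : Ideal (𝓞 K)} (h𝔪 : 𝔪 ≠ ⊥)
    (hiff : ∀ v : HeightOneSpectrum (𝓞 K), χ.IsUnramifiedAt v ↔ ¬ 𝔪 ≤ v.asIdeal)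
    {s : ℂ} (hs : 1 < s.re) :
    heckeLFunction χ s =
      LSeries (NumberField.twistCount K (rayClassCoeffHom 𝔪 fun v ↦ χ.valueAtUniformizer v)) s := by
  rw [heckeLFunction_eq_rayClassLSeries_of_isUnitary hu h𝔪 hiff hs,
    rayClassLSeries_eq_LSeries_twistCount h𝔪
      (fun v _ ↦ (HeckeCharacter.norm_valueAtUniformizer_of_isUnitary hu v).le) hs]

/-- **`L(χ, s)` as a translated Dirichlet series for an ARBITRARY Hecke character** (Weil's
`χ = χ₀ ‖·‖^σ`): there are `σ : ℝ`, a unitary `χ₀` with the same ramification as `χ` and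
`χ₀(ϖ_v) = χ(ϖ_v)·Nv^σ`, and a nonzero modulus `𝔪` cutting out that ramification, such that
`heckeLFunction χ s = LSeries (n ↦ Σ_{N𝔞 = n} χ₀(𝔞)) (s + σ)` for `re s > 1 − σ`.
[cite: WeilBNT1967, Ch. VII §3 Cor. 1–2 and §7 ¶1] [cite: NeukirchANT1999, Ch. VII §8 (8.1)] -/
theorem exists_heckeLFunction_eq_LSeries_translate (χ : HeckeCharacter K) :
    ∃ (σ : ℝ) (χ₀ : HeckeCharacter K) (𝔪 : Ideal (𝓞 K)), χ₀.IsUnitary ∧ 𝔪 ≠ ⊥ ∧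
      (∀ x : ideleGroup K, ‖((χ x : ℂˣ) : ℂ)‖ = ideleNorm x ^ σ) ∧
      (∀ v : HeightOneSpectrum (𝓞 K), χ.IsUnramifiedAt v ↔ ¬ 𝔪 ≤ v.asIdeal) ∧
      (∀ v : HeightOneSpectrum (𝓞 K), χ₀.IsUnramifiedAt v ↔ ¬ 𝔪 ≤ v.asIdeal) ∧
      (∀ v : HeightOneSpectrum (𝓞 K), χ₀.valueAtUniformizer v =
        χ.valueAtUniformizer v * ((Ideal.absNorm v.asIdeal : ℕ) : ℂ) ^ (σ : ℂ)) ∧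
      ∀ s : ℂ, 1 - σ < s.re → heckeLFunction χ s =
        LSeries (NumberField.twistCount K (rayClassCoeffHom 𝔪 fun v ↦ χ₀.valueAtUniformizer v))
          (s + σ) := by
  obtain ⟨σ, χ₀, hu, hσ, hram, hval, hL⟩ := χ.exists_isUnitary_heckeLFunction_eq_translate
  obtain ⟨𝔪, h𝔪, hiff⟩ := exists_ramificationModulus χ
  have hiff₀ : ∀ v : HeightOneSpectrum (𝓞 K), χ₀.IsUnramifiedAt v ↔ ¬ 𝔪 ≤ v.asIdeal :=
    fun v ↦ (hram v).symm.trans (hiff v)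
  refine ⟨σ, χ₀, 𝔪, hu, h𝔪, hσ, hiff, hiff₀, hval, fun s hs ↦ ?_⟩
  rw [hL s]
  exact heckeLFunction_eq_LSeries_twistCount_of_isUnitary hu h𝔪 hiff₀
    (by simp only [Complex.add_re, Complex.ofReal_re]; linarith)

end Rigidity

end Summit.BirchSwinnertonDyer.BirchSwinnertonDyer.Theorems.RamifiedSevenEllipticUnits

end
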